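import Mathlib
import HarnessLib
import HarnessLib.Audit
import Summits.AtomisticToContinuum.FouriersLaw.Theses.CurrentTiltQuench
import Literature.MathematicalPhysics.KineticTheory.InfiniteChainInvariantStates
import Literature.MathematicalPhysics.KineticTheory.InfiniteChainObservables

/-!
# `Lines/odd-charge-split.lean` — strategist line / typed decomposition for crux `BoundedOddRigidity`
(stmt-AtomisticToContinuum-11027; route CurrentTiltQuench, rank 3; unit cstrat-stmt-AtomisticToContinuum-11027-r1, 2026-08-17)

THE CRUX. `BoundedOddRigidity`: for `ω₂, lam, β > 0`, every shift-invariant, time-invariant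
(generator sense, `∫ 𝒜f dν = 0` on `C₀¹`), regular probability measure `ν` of the infinite pinned
chain gives zero mean to every clipped bond current `max(-M, min(M, j_0))`, `M > 0` — equivalently
(differentiate in `M`): the LAW of `j_0` under `ν` is symmetric. It is the odd sector of
macro-ergodicity, a bare symmetry statement; BC2 probes `BoundedOddRigidity → FouriersLaw` and
`FouriersLaw → BoundedOddRigidity` both FAIL (bc/ folder of the unit), so the crux is strictly
inside the summit.

THE LINE (seam CERTIFICATE × STRUCTURE, "Mazur's mechanism read backwards"; the clipped,
law-level form of the registered birth line of the sibling crux `ParityLiouvilleSeed.ZeroCurrentRigidity`,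
stmt-12073, whose stub 2 is the mean-level special case of stub 2 below — one odd-sector programme
for three routes):

* `stub_noLocalIntegrals` — VERBATIM the open item stmt-AtomisticToContinuum-12074
  `LocalOhmBV.NoLocalIntegrals` (difficulty L; grounded: Levi–Yamilov symmetry approach, Yamilov
  2006; evidence on the item: the planner's hand evaluation of the first canonical condition and
  prover c5's exact polynomial census, odd nullity 0 in 117 anharmonic windows): for
  `ω₂, lam, β > 0` every smooth local density whose Liouville derivative is a shift-difference is
  `c·e_0 + (h - h∘τ) + k`. The COMPUTABLE half, where anharmonicity enters (false at `lam = β = 0`).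
* `stub_oddLawOfCurrentAsymmetry` — ASYMMETRIC CURRENT STATISTICS NEED AN ODD LOCAL CHARGE (new;
  universal in the four real parameters, no sign conditions): if under some regular, shift- and
  time-invariant probability measure of `pinnedChain ω₂ lam β γ` some clipped bond current has
  non-zero mean, then the chain admits an `R`-odd (`R : p ↦ -p`) smooth local conservation law
  that is NOT a smooth local shift-coboundary. The STRUCTURAL half: true non-vacuously for the
  harmonic member (witness `p_0(q_1 - q_{-1})`) and for unpinned chains (witness `p_0`) — exactly
  where the crux fails, so it is not the crux in costume; for anharmonic pinned parameters it is
  the open heart (a converse-Mazur / completeness statement: regular invariant states see only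
  local charges). It implies the sibling stub `stub_oddLawOfCurrent` (mean level) by dominated
  convergence.

Composition `BoundedOddRigidity_of : stub₁ → stub₂ → CurrentTiltQuench.BoundedOddRigidity`
(real proof, ~60 lines, no `sorry`): by contradiction, stub 2 gives an odd law `f` that is not a
coboundary; stub 1 writes `f = c·e_0 + (h - h∘τ) + k`; since `e_0 ∘ R = e_0` and `τ ∘ R = R ∘ τ`,
oddness forces `f = g - g∘τ` with the smooth local `g = (h - h∘R)/2` — a coboundary after all.
(Adapted, with acknowledgement, from `Cruxes/ZeroCurrentRigidity/Lines/birth.lean`.)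

Disproof / negatives honoured: no `Disproof.lean` / `Negative/` lemma exists for this crux
(`ledger crux ls`: no workfiles, 2026-08-17); the refuter's crux-attack by-products (Evidence.lean,
2026-08-15: `clip_dirac_witness` — a Dirac mass at an explicit configuration has clipped current
`min M (1+β) ≠ 0`, so the conclusion is hypothesis-dependent) are respected: stub 2 USES
`IsRegular` (its hypothesis), and singular orbit measures (Dirac, travelling waves, KAM tori;
cf. `zeroCurrentRigidity_false_without_regularity` for the sibling) are no instance of it.
Harmonic calibration (SpohnLebowitz1977, HarmonicChainBallisticFlux): stub 2 HOLDS there with a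
witness, stub 1 FAILS there, as it must. Negatives index of the summit: no statement about local
conservation laws or odd charges.
-/

noncomputable section

namespace Summit.AtomisticToContinuum.FouriersLaw.Cruxes.BoundedOddRigidity.OddChargeSplit

open MeasureTheory
open Literature.MathematicalPhysics.KineticTheory.HeatConduction

/-! ## Registered stubs (the only `sorry`s of the line) -/

/-- **stub 1 · `stub_noLocalIntegrals` — NO LOCAL CONSERVATION LAW BESIDES ENERGY** (verbatim the
statement of item stmt-AtomisticToContinuum-12074 `LocalOhmBV.NoLocalIntegrals`; size L). For
`ω₂, lam, β > 0`, every smooth local density `f = g ∘ boxRestrict R` (`g ∈ C^∞`) whose Liouville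
derivative is a total shift-difference `𝒜f = ψ - ψ ∘ τ` (`ψ` smooth local) is of the form
`c·e_0 + (h - h∘τ) + k`, `e_0 = p_0²/2 + U(q_0) + V(q_1 - q_0)`, `h` smooth local, `c, k ∈ ℝ`.
Why plausibly true: symmetry approach to lattice equations `q̈_n = F(q_{n-1}, q_n, q_{n+1})`
(Levi–Yamilov 1997, Yamilov 2006): a conservation law of order ≥ 3 forces the first canonical
integrability condition, which fails for `V''(r) = 1 + 3βr²`, `β > 0`; low orders by hand; exact
polynomial census (prover c5 on 12074). Why it might fail: the printed necessity of the canonical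
conditions covers the Toda-type class under non-degeneracy hypotheses whose verification for the
quartic pinned member is by hand; a non-polynomial local law is not covered by the census.
False at `lam = β = 0` (quadratic charges). -/
theorem stub_noLocalIntegrals :
    ∀ ω₂ lam β γ : ℝ, 0 < ω₂ → 0 < lam → 0 < β → ∀ f : Literature.MathematicalPhysics.KineticTheory.HeatConduction.ChainConfig → ℝ, (∃ (R : ℕ) (g : (Fin (2 * R + 1) → ℝ × ℝ) → ℝ), ContDiff ℝ ((⊤ : ℕ∞) : WithTop ℕ∞) g ∧ f = g ∘ Literature.MathematicalPhysics.KineticTheory.HeatConduction.boxRestrict R) → (∃ ψ : Literature.MathematicalPhysics.KineticTheory.HeatConduction.ChainConfig → ℝ, (∃ (R : ℕ) (g : (Fin (2 * R + 1) → ℝ × ℝ) → ℝ), ContDiff ℝ ((⊤ : ℕ∞) : WithTop ℕ∞) g ∧ ψ = g ∘ Literature.MathematicalPhysics.KineticTheory.HeatConduction.boxRestrict R) ∧ ∀ σ, Literature.MathematicalPhysics.KineticTheory.HeatConduction.liouvilleZ (Literature.MathematicalPhysics.KineticTheory.HeatConduction.pinnedChain ω₂ lam β γ) f σ = ψ σ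 - ψ (Literature.MathematicalPhysics.KineticTheory.HeatConduction.shift σ)) → ∃ (c k : ℝ) (h : Literature.MathematicalPhysics.KineticTheory.HeatConduction.ChainConfig → ℝ), (∃ (R : ℕ) (g : (Fin (2 * R + 1) → ℝ × ℝ) → ℝ), ContDiff ℝ ((⊤ : ℕ∞) : WithTop ℕ∞) g ∧ h = g ∘ Literature.MathematicalPhysics.KineticTheory.HeatConduction.boxRestrict R) ∧ ∀ σ, f σ = c * ((σ 0).2 ^ 2 / 2 + (Literature.MathematicalPhysics.KineticTheory.HeatConduction.pinnedChain ω₂ lam β γ).U (σ 0).1 + (Literature.MathematicalPhysics.KineticTheory.HeatConduction.pinnedChain ω₂ lam β γ).V ((σ 1).1 - (σ 0).1)) + (h σ - h (Literature.MathematicalPhysics.KineticTheory.HeatConduction.shift σ)) + k := by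
  sorry

/-- **stub 2 · `stub_oddLawOfCurrentAsymmetry` — ASYMMETRIC CURRENT STATISTICS NEED AN ODD LOCAL
CHARGE** (new; the structural half; universal in the parameters — no sign conditions). For any real
`ω₂ lam β γ`: if a probability measure `ν` on `(ℝ×ℝ)^ℤ` is shift-invariant, time-invariant for
`pinnedChain ω₂ lam β γ` (generator sense) and regular, and some clipped bond current has non-zero
mean, `∫ max(-M, min(M, j_0)) dν ≠ 0` (`M > 0`), then there is a smooth local density `f`, ODD
under `R : (q, p) ↦ (q, -p)`, which is a local conservation law (`𝒜f = ψ - ψ∘τ`, `ψ` smooth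
local) and NOT a shift-coboundary `g - g∘τ` of a smooth local `g`. Why plausibly true: every
known regular stationary state of an oscillator chain with asymmetric current statistics is
carried by an odd local charge — harmonic radiating states (`f = p_0(q_1 - q_{-1})`, making the
stub TRUE at `lam = β = 0`), boosted states of unpinned chains (`f = p_0`), Toda; Mazur's
inequality is the only known mechanism for persistent currents, and regularity (finite entropy
density) excludes the singular KAM / breather / travelling-wave invariant states. Why it might
fail: a regular invariant state protected by a QUASI-local (not strictly local) odd charge, or by
no charge at all (non-integrable resonance); a regular state with zero MEAN current but asymmetric
law not traceable to a charge. Size: open (the heart of the line for anharmonic pinned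
parameters); M for the harmonic and unpinned special cases. -/
theorem stub_oddLawOfCurrentAsymmetry :
    ∀ ω₂ lam β γ : ℝ, ∀ ν : MeasureTheory.Measure Literature.MathematicalPhysics.KineticTheory.HeatConduction.ChainConfig, MeasureTheory.IsProbabilityMeasure ν → Literature.MathematicalPhysics.KineticTheory.HeatConduction.IsShiftInvariant ν → Literature.MathematicalPhysics.KineticTheory.HeatConduction.IsTimeInvariant (Literature.MathematicalPhysics.KineticTheory.HeatConduction.pinnedChain ω₂ lam β γ) ν → Literature.MathematicalPhysics.KineticTheory.HeatConduction.IsRegular (Literature.MathematicalPhysics.KineticTheory.HeatConduction.pinnedChain ω₂ lam β γ) ν → ∀ M : ℝ, 0 < M → ∫ σ, max (-M) (min M ((Literature.MathematicalPhysics.KineticTheory.HeatConduction.pinnedChain ω₂ lam β γ).bondCurrentZ σ 0)) ∂ν ≠ 0 → ∃ f : Literature.MathematicalPhysics.KineticTheory.HeatConduction.ChainConfig → ℝ, (∃ (R : ℕ) (g : (Fin (2 * R + 1) → ℝ × ℝ) → ℝ), ContDiff ℝ ((⊤ : ℕ∞) : WithTop ℕ∞) g ∧ f = g ∘ Literature.MathematicalPhysics.KineticTheory.HeatConduction.boxRestrict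 R) ∧ (∀ σ : Literature.MathematicalPhysics.KineticTheory.HeatConduction.ChainConfig, f (fun x => ((σ x).1, -(σ x).2)) = -f σ) ∧ (∃ ψ : Literature.MathematicalPhysics.KineticTheory.HeatConduction.ChainConfig → ℝ, (∃ (R : ℕ) (g : (Fin (2 * R + 1) → ℝ × ℝ) → ℝ), ContDiff ℝ ((⊤ : ℕ∞) : WithTop ℕ∞) g ∧ ψ = g ∘ Literature.MathematicalPhysics.KineticTheory.HeatConduction.boxRestrict R) ∧ ∀ σ, Literature.MathematicalPhysics.KineticTheory.HeatConduction.liouvilleZ (Literature.MathematicalPhysics.KineticTheory.HeatConduction.pinnedChain ω₂ lam β γ) f σ = ψ σ - ψ (Literature.MathematicalPhysics.KineticTheory.HeatConduction.shift σ)) ∧ ¬ ∃ h : Literature.MathematicalPhysics.KineticTheory.HeatConduction.ChainConfig → ℝ, (∃ (R : ℕ) (g : (Fin (2 * R + 1) → ℝ × ℝ) → ℝ), ContDiff ℝ ((⊤ : ℕ∞) : WithTop ℕ∞) g ∧ h = g ∘ Literature.MathematicalPhysics.KineticTheory.HeatConduction.boxRestrict R) ∧ ∀ σ, f σ = h σ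 - h (Literature.MathematicalPhysics.KineticTheory.HeatConduction.shift σ) := by
  sorry

/-! ## Name-keyed aliases of the two statements (the hypothesis types of the composition)

`Registered.stub_*` is VERBATIM the statement of the theorem `stub_*` above (the wiring `example`
at the end certifies it definitionally); the composition takes the stubs as hypotheses BY NAME. -/

namespace Registered

/-- Verbatim statement of `stub_noLocalIntegrals` (= item stmt-AtomisticToContinuum-12074). -/
def stub_noLocalIntegrals : Prop :=
  ∀ ω₂ lam β γ : ℝ, 0 < ω₂ → 0 < lam → 0 < β → ∀ f : Literature.MathematicalPhysics.KineticTheory.HeatConduction.ChainConfig → ℝ, (∃ (R : ℕ) (g : (Fin (2 * R + 1) → ℝ × ℝ) → ℝ), ContDiff ℝ ((⊤ : ℕ∞) : WithTop ℕ∞) g ∧ f = g ∘ Literature.MathematicalPhysics.KineticTheory.HeatConduction.boxRestrict R) → (∃ ψ : Literature.MathematicalPhysics.KineticTheory.HeatConduction.ChainConfig → ℝ, (∃ (R : ℕ) (g : (Fin (2 * R + 1) → ℝ × ℝ) → ℝ), ContDiff ℝ ((⊤ : ℕ∞) : WithTop ℕ∞) g ∧ ψ = g ∘ Literature.MathematicalPhysics.KineticTheory.HeatConduction.boxRestrict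 R) ∧ ∀ σ, Literature.MathematicalPhysics.KineticTheory.HeatConduction.liouvilleZ (Literature.MathematicalPhysics.KineticTheory.HeatConduction.pinnedChain ω₂ lam β γ) f σ = ψ σ - ψ (Literature.MathematicalPhysics.KineticTheory.HeatConduction.shift σ)) → ∃ (c k : ℝ) (h : Literature.MathematicalPhysics.KineticTheory.HeatConduction.ChainConfig → ℝ), (∃ (R : ℕ) (g : (Fin (2 * R + 1) → ℝ × ℝ) → ℝ), ContDiff ℝ ((⊤ : ℕ∞) : WithTop ℕ∞) g ∧ h = g ∘ Literature.MathematicalPhysics.KineticTheory.HeatConduction.boxRestrict R) ∧ ∀ σ, f σ = c * ((σ 0).2 ^ 2 / 2 + (Literature.MathematicalPhysics.KineticTheory.HeatConduction.pinnedChain ω₂ lam β γ).U (σ 0).1 + (Literature.MathematicalPhysics.KineticTheory.HeatConduction.pinnedChain ω₂ lam β γ).V ((σ 1).1 - (σ 0).1)) + (h σ - h (Literature.MathematicalPhysics.KineticTheory.HeatConduction.shift σ)) + k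

/-- Verbatim statement of `stub_oddLawOfCurrentAsymmetry`. -/
def stub_oddLawOfCurrentAsymmetry : Prop :=
  ∀ ω₂ lam β γ : ℝ, ∀ ν : MeasureTheory.Measure Literature.MathematicalPhysics.KineticTheory.HeatConduction.ChainConfig, MeasureTheory.IsProbabilityMeasure ν → Literature.MathematicalPhysics.KineticTheory.HeatConduction.IsShiftInvariant ν → Literature.MathematicalPhysics.KineticTheory.HeatConduction.IsTimeInvariant (Literature.MathematicalPhysics.KineticTheory.HeatConduction.pinnedChain ω₂ lam β γ) ν → Literature.MathematicalPhysics.KineticTheory.HeatConduction.IsRegular (Literature.MathematicalPhysics.KineticTheory.HeatConduction.pinnedChain ω₂ lam β γ) ν → ∀ M : ℝ, 0 < M → ∫ σ, max (-M) (min M ((Literature.MathematicalPhysics.KineticTheory.HeatConduction.pinnedChain ω₂ lam β γ).bondCurrentZ σ 0)) ∂ν ≠ 0 → ∃ f : Literature.MathematicalPhysics.KineticTheory.HeatConduction.ChainConfig → ℝ, (∃ (R : ℕ) (g : (Fin (2 * R + 1) → ℝ × ℝ) → ℝ), ContDiff ℝ ((⊤ : ℕ∞) : WithTop ℕ∞)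 g ∧ f = g ∘ Literature.MathematicalPhysics.KineticTheory.HeatConduction.boxRestrict R) ∧ (∀ σ : Literature.MathematicalPhysics.KineticTheory.HeatConduction.ChainConfig, f (fun x => ((σ x).1, -(σ x).2)) = -f σ) ∧ (∃ ψ : Literature.MathematicalPhysics.KineticTheory.HeatConduction.ChainConfig → ℝ, (∃ (R : ℕ) (g : (Fin (2 * R + 1) → ℝ × ℝ) → ℝ), ContDiff ℝ ((⊤ : ℕ∞) : WithTop ℕ∞) g ∧ ψ = g ∘ Literature.MathematicalPhysics.KineticTheory.HeatConduction.boxRestrict R) ∧ ∀ σ, Literature.MathematicalPhysics.KineticTheory.HeatConduction.liouvilleZ (Literature.MathematicalPhysics.KineticTheory.HeatConduction.pinnedChain ω₂ lam β γ) f σ = ψ σ - ψ (Literature.MathematicalPhysics.KineticTheory.HeatConduction.shift σ)) ∧ ¬ ∃ h : Literature.MathematicalPhysics.KineticTheory.HeatConduction.ChainConfig → ℝ, (∃ (R : ℕ) (g : (Fin (2 * R + 1) → ℝ × ℝ) → ℝ), ContDiff ℝ ((⊤ : ℕ∞) : WithTop ℕ∞) g ∧ h = g ∘ Literature.MathematicalPhysics.KineticTheory.HeatConduction.boxRestrict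 R) ∧ ∀ σ, f σ = h σ - h (Literature.MathematicalPhysics.KineticTheory.HeatConduction.shift σ)

end Registered

/-! ## The composition: the two stubs give the crux BY NAME (no `sorry` below) -/

/-- **`BoundedOddRigidity` from the two stubs.** By contradiction: a regular space-time invariant
state with `∫ max(-M, min(M, j_0)) dν ≠ 0` yields (stub 2) an `R`-odd smooth local conservation
law `f` that is not a coboundary; the census (stub 1) writes `f = c·e_0 + (h - h∘τ) + k`; `e_0`
is `R`-even and `τ (Rσ) = R (τσ)`, so `f = ½(f - f∘R) = g - g∘τ` with `g = ½(h - h∘R)`, which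
is smooth local (`h∘R = (G ∘ R_box) ∘ boxRestrict R₀` for the linear box reversal `R_box`) — a
coboundary after all. -/
theorem BoundedOddRigidity_of (h1 : Registered.stub_noLocalIntegrals)
    (h2 : Registered.stub_oddLawOfCurrentAsymmetry) :
    Summit.AtomisticToContinuum.FouriersLaw.Theses.CurrentTiltQuench.BoundedOddRigidity := by
  intro ω₂ lam β γ hω hl hβ ν hprob hshift htime hreg M hM
  by_contra hJ
  obtain ⟨f, hfloc, hodd, hcons, hnot⟩ := h2 ω₂ lam β γ ν hprob hshift htime hreg M hM hJ
  obtain ⟨c, k, h, ⟨R, G, hG, hhG⟩, hform⟩ := h1 ω₂ lam β γ hω hl hβ f hfloc hcons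
  apply hnot
  -- the (linear) momentum reversal of the centred box `{-R, …, R}`
  let L : (Fin (2 * R + 1) → ℝ × ℝ) →L[ℝ] (Fin (2 * R + 1) → ℝ × ℝ) :=
    ContinuousLinearMap.pi fun i =>
      ((ContinuousLinearMap.fst ℝ ℝ ℝ).comp (ContinuousLinearMap.proj i)).prod
        (-((ContinuousLinearMap.snd ℝ ℝ ℝ).comp (ContinuousLinearMap.proj i)))
  have hL : ∀ (y : Fin (2 * R + 1) → ℝ × ℝ) (i : Fin (2 * R + 1)), L y i = ((y i).1, -(y i).2) := by
    intro y i
    simp [L]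
  have hbox : ∀ σ : ChainConfig,
      boxRestrict R (fun x => ((σ x).1, -(σ x).2)) = L (boxRestrict R σ) := by
    intro σ
    funext i
    rw [hL]
    rfl
  have hh : ∀ σ : ChainConfig, h σ = G (boxRestrict R σ) := by
    intro σ
    rw [hhG]
    rfl
  have hhR : ∀ σ : ChainConfig, h (fun x => ((σ x).1, -(σ x).2)) = G (L (boxRestrict R σ)) := by
    intro σ
    rw [hh, hbox]
  refine ⟨fun σ => (h σ - h (fun x => ((σ x).1, -(σ x).2))) / 2,
    ⟨R, fun y => (G y - G (L y)) / 2, ?_, ?_⟩, ?_⟩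
  · exact (hG.sub (hG.comp L.contDiff)).div_const 2
  · funext σ
    simp only [Function.comp_apply]
    rw [hhR σ, hh σ]
  · intro σ
    -- the census at `σ` and at `Rσ`, and oddness of `f`
    have e1 := hform σ
    have e2 := hform (fun x => ((σ x).1, -(σ x).2))
    have e3 := hodd σ
    have hs : shift (fun x => ((σ x).1, -(σ x).2)) =
        fun x => (((shift σ) x).1, -((shift σ) x).2) := by
      funext x
      rfl
    have hE : ((fun x : ℤ => ((σ x).1, -(σ x).2)) 0).2 ^ 2 / 2 +
          (pinnedChain ω₂ lam β γ).U ((fun x : ℤ => ((σ x).1, -(σ x).2)) 0).1 +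
          (pinnedChain ω₂ lam β γ).V (((fun x : ℤ => ((σ x).1, -(σ x).2)) 1).1 -
            ((fun x : ℤ => ((σ x).1, -(σ x).2)) 0).1) =
        (σ 0).2 ^ 2 / 2 + (pinnedChain ω₂ lam β γ).U (σ 0).1 +
          (pinnedChain ω₂ lam β γ).V ((σ 1).1 - (σ 0).1) := by
      simp only [neg_sq]
    rw [hs, hE] at e2
    simp only
    linarith


/-- Wiring check: the two registered stubs feed `BoundedOddRigidity_of` exactly as stated (their
verbatim statements are definitionally the `Registered.*` aliases). An `example`, so that
`BoundedOddRigidity_of` stays the only theorem of the file concluding the crux. -/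
example : Summit.AtomisticToContinuum.FouriersLaw.Theses.CurrentTiltQuench.BoundedOddRigidity :=
  BoundedOddRigidity_of stub_noLocalIntegrals stub_oddLawOfCurrentAsymmetry

end Summit.AtomisticToContinuum.FouriersLaw.Cruxes.BoundedOddRigidity.OddChargeSplit

end
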